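import Mathlib
import Summits.Ventures.PercRepro2.MixChordOStar3Conn
import Summits.Ventures.PercRepro2.MixChordOStarWorldsUniv

/-!
# THE THREE-PIN STAR: the eight worlds of the pins `g = {a₃, o}`, `e = {a₃, a₁}`, `d = {a₃, a₂}` (blind cell
PercRepro2, night-1 g27; proofs/NIGHT1-G26.md §7 (1), the successor's programme)

The world configurations `ω[g ↦ c₁][e ↦ c₂][d ↦ c₃]` through the base configuration `ω₀ = ω[g ↦ 0][e ↦ 0][d ↦ 0]`
(`upd100` …), the world probabilities as preimage probabilities (`prob_w000` … `prob_w111`, `prob_w000f`), and the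
**eight-world mixture** `prob_eq_pin3`.  The connectivity readings of the worlds are in Star3Readings.lean.
Own code; standard axioms.
-/

namespace Summit.Ventures.PercRepro2

open UnionCluster CovForm

namespace Mix

open OStar

namespace OStar3

section Pins

variable {V : Type*} {E : Type*} [Fintype E] [DecidableEq E] {R : Type*} [Field R]

variable {ends : E → Sym2 V} {g e d f : E} {o a₁ a₂ a₃ : V}

omit [Fintype E] in
/-- The base configuration has `g` closed. -/
lemma base3_g (hge : g ≠ e) (hgd : g ≠ d) (ω : Config E) :
    Function.update (Function.update (Function.update ω g false) e false) d false g = false := by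
  rw [Function.update_of_ne hgd, Function.update_of_ne hge, Function.update_self]

omit [Fintype E] in
/-- The base configuration has `e` closed. -/
lemma base3_e (hed : e ≠ d) (ω : Config E) :
    Function.update (Function.update (Function.update ω g false) e false) d false e = false := by
  rw [Function.update_of_ne hed, Function.update_self]

omit [Fintype E] in
/-- The base configuration has `d` closed. -/
lemma base3_d (ω : Config E) :
    Function.update (Function.update (Function.update ω g false) e false) d false d = false := by
  rw [Function.update_self]

omit [Fintype E] in
/-- `ω[g ↦ 1][e ↦ 0][d ↦ 0]` through the base configuration. -/
lemma upd100 (hge : g ≠ e) (hgd : g ≠ d) (ω : Config E) :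
    Function.update (Function.update (Function.update ω g true) e false) d false =
      Function.update (Function.update (Function.update (Function.update ω g false) e false) d false) g true := by
  rw [Function.update_comm hgd.symm, Function.update_comm hge.symm, Function.update_idem]

omit [Fintype E] in
/-- `ω[g ↦ 0][e ↦ 1][d ↦ 0]` through the base configuration. -/
lemma upd010 (hed : e ≠ d) (ω : Config E) :
    Function.update (Function.update (Function.update ω g false) e true) d false =
      Function.update (Function.update (Function.update (Function.update ω g false) e false) d false) e true := by
  rw [Function.update_comm hed.symm, Function.update_idem]

omit [Fintype E] in
/-- `ω[g ↦ 0][e ↦ 0][d ↦ 1]` through the base configuration. -/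
lemma upd001 (ω : Config E) :
    Function.update (Function.update (Function.update ω g false) e false) d true =
      Function.update (Function.update (Function.update (Function.update ω g false) e false) d false) d true := by
  rw [Function.update_idem]

omit [Fintype E] in
/-- `ω[g ↦ 1][e ↦ 1][d ↦ 0]` through the base configuration. -/
lemma upd110 (hge : g ≠ e) (hgd : g ≠ d) (hed : e ≠ d) (ω : Config E) :
    Function.update (Function.update (Function.update ω g true) e true) d false =
      Function.update (Function.update (Function.update (Function.update (Function.update ω g false) e false) d false)
        g true) e true := by
  rw [← upd100 hge hgd, Function.update_comm hed.symm, Function.update_idem]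

omit [Fintype E] in
/-- `ω[g ↦ 1][e ↦ 0][d ↦ 1]` through the base configuration. -/
lemma upd101 (hge : g ≠ e) (hgd : g ≠ d) (ω : Config E) :
    Function.update (Function.update (Function.update ω g true) e false) d true =
      Function.update (Function.update (Function.update (Function.update (Function.update ω g false) e false) d false)
        g true) d true := by
  rw [← upd100 hge hgd, Function.update_idem]

omit [Fintype E] in
/-- `ω[g ↦ 0][e ↦ 1][d ↦ 1]` through the base configuration. -/
lemma upd011 (hed : e ≠ d) (ω : Config E) :
    Function.update (Function.update (Function.update ω g false) e true) d true =
      Function.update (Function.update (Function.update (Function.update (Function.update ω g false) e false) d false)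
        e true) d true := by
  rw [← upd010 hed, Function.update_idem]

omit [Fintype E] in
/-- `ω[g ↦ 1][e ↦ 1][d ↦ 1]` through the base configuration. -/
lemma upd111 (hge : g ≠ e) (hgd : g ≠ d) (hed : e ≠ d) (ω : Config E) :
    Function.update (Function.update (Function.update ω g true) e true) d true =
      Function.update (Function.update (Function.update (Function.update (Function.update
        (Function.update ω g false) e false) d false) g true) e true) d true := by
  rw [← upd110 hge hgd hed, Function.update_idem]

variable (p : E → R)

/-- `P_{p[g↦0][e↦0][d↦0]}(A)` as a preimage probability. -/
lemma prob_w000 (A : Set (Config E)) :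
    prob (Function.update (Function.update (Function.update p g 0) e 0) d 0) A =
      prob p {ω | Function.update (Function.update (Function.update ω g false) e false) d false ∈ A} := by
  rw [CCT.prob_update_zero_eq, CCT.prob_update_zero_eq, CCT.prob_update_zero_eq]
  rfl

/-- `P_{p[g↦1][e↦0][d↦0]}(A)` as a preimage probability. -/
lemma prob_w100 (A : Set (Config E)) :
    prob (Function.update (Function.update (Function.update p g 1) e 0) d 0) A =
      prob p {ω | Function.update (Function.update (Function.update ω g true) e false) d false ∈ A} := by
  rw [CCT.prob_update_zero_eq, CCT.prob_update_zero_eq, CCT.prob_update_one_eq]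
  rfl

/-- `P_{p[g↦0][e↦1][d↦0]}(A)` as a preimage probability. -/
lemma prob_w010 (A : Set (Config E)) :
    prob (Function.update (Function.update (Function.update p g 0) e 1) d 0) A =
      prob p {ω | Function.update (Function.update (Function.update ω g false) e true) d false ∈ A} := by
  rw [CCT.prob_update_zero_eq, CCT.prob_update_one_eq, CCT.prob_update_zero_eq]
  rfl

/-- `P_{p[g↦0][e↦0][d↦1]}(A)` as a preimage probability. -/
lemma prob_w001 (A : Set (Config E)) :
    prob (Function.update (Function.update (Function.update p g 0) e 0) d 1) A =
      prob p {ω | Function.update (Function.update (Function.update ω g false) e false) d true ∈ A} := by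
  rw [CCT.prob_update_one_eq, CCT.prob_update_zero_eq, CCT.prob_update_zero_eq]
  rfl

/-- `P_{p[g↦1][e↦1][d↦0]}(A)` as a preimage probability. -/
lemma prob_w110 (A : Set (Config E)) :
    prob (Function.update (Function.update (Function.update p g 1) e 1) d 0) A =
      prob p {ω | Function.update (Function.update (Function.update ω g true) e true) d false ∈ A} := by
  rw [CCT.prob_update_zero_eq, CCT.prob_update_one_eq, CCT.prob_update_one_eq]
  rfl

/-- `P_{p[g↦1][e↦0][d↦1]}(A)` as a preimage probability. -/
lemma prob_w101 (A : Set (Config E)) :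
    prob (Function.update (Function.update (Function.update p g 1) e 0) d 1) A =
      prob p {ω | Function.update (Function.update (Function.update ω g true) e false) d true ∈ A} := by
  rw [CCT.prob_update_one_eq, CCT.prob_update_zero_eq, CCT.prob_update_one_eq]
  rfl

/-- `P_{p[g↦0][e↦1][d↦1]}(A)` as a preimage probability. -/
lemma prob_w011 (A : Set (Config E)) :
    prob (Function.update (Function.update (Function.update p g 0) e 1) d 1) A =
      prob p {ω | Function.update (Function.update (Function.update ω g false) e true) d true ∈ A} := by
  rw [CCT.prob_update_one_eq, CCT.prob_update_one_eq, CCT.prob_update_zero_eq]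
  rfl

/-- `P_{p[g↦1][e↦1][d↦1]}(A)` as a preimage probability. -/
lemma prob_w111 (A : Set (Config E)) :
    prob (Function.update (Function.update (Function.update p g 1) e 1) d 1) A =
      prob p {ω | Function.update (Function.update (Function.update ω g true) e true) d true ∈ A} := by
  rw [CCT.prob_update_one_eq, CCT.prob_update_one_eq, CCT.prob_update_one_eq]
  rfl

/-- `P_{p[g↦0][e↦0][d↦0][f↦1]}(A)` as a preimage probability. -/
lemma prob_w000f (A : Set (Config E)) :
    prob (Function.update (Function.update (Function.update (Function.update p g 0) e 0) d 0) f 1) A =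
      prob p {ω | Function.update (Function.update (Function.update (Function.update ω g false) e false) d false)
        f true ∈ A} := by
  rw [CCT.prob_update_one_eq, CCT.prob_update_zero_eq, CCT.prob_update_zero_eq, CCT.prob_update_zero_eq]
  rfl

/-- **The three-pin mixture**: `P_p(A)` over the eight worlds of the edges `g`, `e`, `d`. -/
lemma prob_eq_pin3 (hge : g ≠ e) (hgd : g ≠ d) (hed : e ≠ d) (A : Set (Config E)) :
    prob p A =
      (1 - p g) * (1 - p e) * (1 - p d) * prob (Function.update (Function.update (Function.update p g 0) e 0) d 0) A +
        p g * (1 - p e) * (1 - p d) * prob (Function.update (Function.update (Function.update p g 1) e 0) d 0) A +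
        (1 - p g) * p e * (1 - p d) * prob (Function.update (Function.update (Function.update p g 0) e 1) d 0) A +
        (1 - p g) * (1 - p e) * p d * prob (Function.update (Function.update (Function.update p g 0) e 0) d 1) A +
        p g * p e * (1 - p d) * prob (Function.update (Function.update (Function.update p g 1) e 1) d 0) A +
        p g * (1 - p e) * p d * prob (Function.update (Function.update (Function.update p g 1) e 0) d 1) A +
        (1 - p g) * p e * p d * prob (Function.update (Function.update (Function.update p g 0) e 1) d 1) A +
        p g * p e * p d * prob (Function.update (Function.update (Function.update p g 1) e 1) d 1) A := by
  rw [prob_eq_pin p A g, prob_eq_pin (Function.update p g 1) A e, prob_eq_pin (Function.update p g 0) A e,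
    prob_eq_pin (Function.update (Function.update p g 1) e 1) A d,
    prob_eq_pin (Function.update (Function.update p g 1) e 0) A d,
    prob_eq_pin (Function.update (Function.update p g 0) e 1) A d,
    prob_eq_pin (Function.update (Function.update p g 0) e 0) A d,
    Function.update_of_ne hge.symm, Function.update_of_ne hge.symm,
    Function.update_of_ne hed.symm, Function.update_of_ne hgd.symm,
    Function.update_of_ne hed.symm, Function.update_of_ne hgd.symm,
    Function.update_of_ne hed.symm, Function.update_of_ne hgd.symm,
    Function.update_of_ne hed.symm, Function.update_of_ne hgd.symm]
  ring

end Pins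

end OStar3

end Mix

end Summit.Ventures.PercRepro2
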